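import Summits.BirchSwinnertonDyer.BirchSwinnertonDyer.Theorems.ThetaPartnerAtTwoSignedControlAtTwoShaTwoPrimaryVanishingOdd
import HarnessLib

/-!
# `Ш²(K, E[p^∞]) = 0` for a TOTALLY COMPLEX number field `K` and EVERY prime `p` (including `p = 2`), modulo
# Poitou–Tate (a) alone — the `p = 2` twin of the odd-prime theorem

Crux K4 `SignedControlAtTwo` (stmt-BirchSwinnertonDyer-20309; routes `ThetaPartnerAtTwo` / `ResidualThetaTransportAtTwo`);
seat `bsd-inputs-k4-p1` (`--supports stmt-BirchSwinnertonDyer-20309`, helper; CONDITIONAL on `poitouTate_sha_tateDual K`).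
Sequel of `…ShaTwoPrimaryVanishingOdd` (seat bsd-inputs-k4-p1 g1, p617570: for `p ≠ 2` and EVERY number field,
`Ш²(K, E[p^∞]) = 0` modulo `poitouTate_sha_tateDual K` alone — `cd_p(Γ_K) ≤ 2` and `2 · H²(K_w, ·) = 0` at the infinite places
make both archimedean Poitou–Tate rows idle).  At `p = 2` the same two inputs are available when `K` is TOTALLY COMPLEX:
`cd_2(Γ_K) ≤ 2` (Serre II §4.4 Prop. 13, tree theorem `fieldCdLE_two_of_numberField_holds` with `IsTotallyComplex`), and
`H²(K_w, ·) = 0` at every (complex) infinite place `w` (`WeakLeopoldt.localization_inl_two_eq_zero`).  Hence, uniformly in `p`: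

* `subsingleton_galoisCohomology_three_torsion_of_isTotallyComplex` — `H³(K, E[p]) = 0`;
* `exists_nsmul_eq_of_mem_shaTwo_of_isTotallyComplex` — `Ш²(K, E[p^∞])` is `p`-divisible inside itself;
* **`forall_mem_shaTwo_primary_eq_zero_of_isTotallyComplex`**, **`shaTwo_primary_eq_bot_of_isTotallyComplex`** —
  `Ш²(K, E[p^∞]) = 0` given `poitouTate_sha_tateDual K`, `Sel_{p^∞}(E/K)` finite and `E(K)[p] = 0` — for imaginary quadratic /
  CM base fields at `p = 2` this is the input «(γ−1)H = H» / «no finite Λ-submodule» WITHOUT the archimedean rows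
  `poitouTate_three_realPlaces_injective` / `poitouTate_two_realPlaces_surjective` that the totally-real door
  `forall_mem_shaTwo_primary_eq_zero_of_poitouTate` displays;
* `forall_exists_conjH1_sub_eq_of_isTotallyComplex`, `dual_forall_finite_eq_bot_of_isTotallyComplex` — the two Greenberg
  Prop. 4.12-type consequences (DIV and «no finite Λ-submodule in the dual of `H¹(K_∞, E[p^∞])`»), any `ℤ_p`-extension.

HONEST FRAMING. THEOREMS ONLY (no definition, no named fact, no `sorry`); CONDITIONAL on `poitouTate_sha_tateDual K`;
closes no item; BSD is not proved by any of this.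
References: [MilneADT2006] I Thm. 4.10 (a), Lemma 6.12, Thm. 6.13 (c); [SerreGaloisCohomology1997] II §4.4 Prop. 13;
[GreenbergLNM1716] §4 Appendix Prop. 4.9–4.12.
-/

set_option autoImplicit false
-- the Theorems namespace of this sub repeats the summit name by design (D-0017 nested layout)
set_option linter.dupNamespace false

noncomputable section

open scoped Classical NumberField

namespace Summit.BirchSwinnertonDyer.BirchSwinnertonDyer.Theorems.SignedEC.PrimaryTorsionH2

open Function NumberField IsDedekindDomain Field WeierstrassCurve
open _root_.TopRep _root_.ContinuousCohomology
open Literature.NumberTheory.EllipticCurves Literature.NumberTheory.GaloisRepresentations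
open Literature.NumberTheory.GaloisRepresentations.DiscreteGaloisModule (shaTwo mem_shaTwo_iff)
open Literature.NumberTheory.GaloisCohomology
open Summit.BirchSwinnertonDyer.Rank1Residual.X11b
open Summit.BirchSwinnertonDyer.Rank1Residual.X11b.Levels (primaryInclusion)

variable {K : Type} [Field K] [NumberField K] [IsTotallyComplex K] (W : WeierstrassCurve K) [W.IsElliptic]
  (p : ℕ) [hp : Fact p.Prime]

omit [W.IsElliptic] in
/-- **`H³(K, E[p]) = 0` for a totally complex number field `K` and EVERY prime `p`**: `cd_p(Γ_K) ≤ 2` (Serre II §4.4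
Prop. 13 — for `p = 2` this needs `K` totally complex; tree theorem `fieldCdLE_two_of_numberField_holds`) and `E[p]` is
`p`-primary. [cite: SerreGaloisCohomology1997, II §4.4 Prop. 13] -/
theorem subsingleton_galoisCohomology_three_torsion_of_isTotallyComplex :
    Subsingleton (galoisCohomology (W.torsionGaloisModule ((p : ℕ) : ℤ)) 3) := by
  have hcd : GroupCdLE (absoluteGaloisGroup K) p 2 :=
    fieldCdLE_two_of_isTotallyComplex fieldCdLE_two_of_numberField_holds K p
  have hprim : IsPrimaryTorsion p (W.geomTorsion ((p : ℕ) : ℤ)) := fun P ↦ by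
    have hP : ((p : ℕ) : ℤ) • (P : W.geomPoints) = 0 := (W.mem_geomTorsion_iff _ _).mp P.2
    refine ⟨1, Subtype.ext ?_⟩
    rw [AddSubgroupClass.coe_nsmul, pow_one, ← natCast_zsmul, hP]
    rfl
  exact hcd _ (W.torsionGaloisModule ((p : ℕ) : ℤ)) hprim (by norm_num)

/-- **Halving in `Ш²(K, E[p^∞])`, totally complex `K`, every prime** (Milne I Lemma 6.12 / Thm. 6.13 (c) inside `Ш²`):
`c = ι_M z`, `z ∈ Ш²(K, E[p^M])`; `z = p_* y` along `0 → E[p] → E[p^{M+1}] →ᵖ E[p^M] → 0` since `H³(K, E[p]) = 0`;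
`c' = ι_{M+1} y` lies in `Ш²` (finite places: `H²(K_v, E[p^∞]) = 0`; infinite places are complex: `H²(K_w, ·) = 0`) and
`p · c' = c`. [cite: MilneADT2006, Ch. I, Lemma 6.12, Thm. 6.13 (c)] [cite: SerreGaloisCohomology1997, II §4.4 Prop. 13] -/
theorem exists_nsmul_eq_of_mem_shaTwo_of_isTotallyComplex
    (c : galoisCohomology (LocBridge.primaryGaloisModule W p) 2)
    (hc : c ∈ shaTwo (LocBridge.primaryGaloisModule W p)) :
    ∃ c' ∈ shaTwo (LocBridge.primaryGaloisModule W p), p • c' = c := by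
  haveI : NeZero p := ⟨hp.out.ne_zero⟩
  haveI : Finite (W.geomTorsion ((p : ℕ) : ℤ)) := finite_geomTorsion_of_neZero W p
  haveI : CompactSpace (absoluteGaloisGroup K) := absoluteGaloisGroup_compactSpace K
  obtain ⟨M, -, z, hz, rfl⟩ := ShaTwo.exists_mem_shaTwo_map_primaryInclusion_eq W p c hc
  have hses := ShaTwo.isSES_torsionInclusion_levelMul W p M
  haveI := subsingleton_galoisCohomology_three_torsion_of_isTotallyComplex W p
  obtain ⟨y, hy⟩ := ShaTwo.IsSES.exists_map_two_eq_of_forall_localization_inl hses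
    (fun c _ ↦ Subsingleton.elim _ _) z (fun w ↦ (mem_shaTwo_iff _ _).1 hz (Sum.inl w))
  rw [DiscreteGaloisModule.cohomologyMap_homOfIntertwining] at hy
  refine ⟨galoisCohomology.map (primaryInclusion W p (M + 1)) 2 y, (mem_shaTwo_iff _ _).2 ?_, ?_⟩
  · rintro (w | v)
    · -- infinite place: complex, `H²(K_w, ·) = 0`
      exact WeakLeopoldt.localization_inl_two_eq_zero (IsTotallyComplex.isComplex w) _
    · -- finite place: `H²(K_v, E[p^∞]) = 0`
      haveI := subsingleton_galoisCohomology_two_toLocal_primaryTorsion W p v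
        (LocBridge.primaryGaloisModule W p) (fun _ _ ↦ rfl)
      exact Subsingleton.elim _ _
  · rw [← hy, ShaTwo.map_two_map_two_eq_nsmul_map_two (Levels.levelMul W p M 1) (primaryInclusion W p M)
      (primaryInclusion W p (M + 1)) (p ^ 1) (Levels.primaryInclusion_levelMul W p M 1), pow_one]

/-- **`Ш²(K, E[p^∞]) = 0` for every totally complex number field `K` and EVERY prime `p`, modulo Poitou–Tate (a) alone**:
given `poitouTate_sha_tateDual K` (finiteness, w2's `finite_shaTwo_primary_and_natCard_le`), `Sel_{p^∞}(E/K)` finite and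
`E[p^∞]^{Γ_K} = 0`, the finite `p`-primary `p`-divisible group `Ш²` vanishes.
[cite: MilneADT2006, Ch. I, Thm. 4.10 (a), Thm. 6.13 (c)] [cite: SerreGaloisCohomology1997, II §4.4 Prop. 13] -/
theorem forall_mem_shaTwo_primary_eq_zero_of_isTotallyComplex (hPT : poitouTate_sha_tateDual K)
    [Finite (W.selmerGroupPInfty p)]
    (hΓ : ∀ Q : W.geomPrimaryTorsion p,
      (∀ σ : absoluteGaloisGroup K, LocBridge.primaryGaloisModule W p σ Q = Q) → Q = 0) :
    ∀ c ∈ shaTwo (LocBridge.primaryGaloisModule W p), c = 0 := by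
  haveI := (ShaTwo.finite_shaTwo_primary_and_natCard_le W p hPT hΓ).1
  exact ShaTwo.eq_zero_of_finite_of_primary_of_divisible p (shaTwo (LocBridge.primaryGaloisModule W p))
    (fun c _ ↦ Summit.BirchSwinnertonDyer.Rank1Residual.X11b.WeakLeopoldt.exists_pow_smul_eq_zero W p c)
    (fun c hc ↦ exists_nsmul_eq_of_mem_shaTwo_of_isTotallyComplex W p c hc)

/-- **`Ш²(K, E[p^∞]) = ⊥`, `K` totally complex, every prime `p`, `Sel_{p^∞}(E/K)` finite, `E(K)[p] = 0`** (the latter as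
`hK : ∀ P, p • P = 0 → P = 0`), modulo `poitouTate_sha_tateDual K` alone.
[cite: MilneADT2006, Ch. I, Thm. 4.10 (a), Thm. 6.13 (c)] -/
theorem shaTwo_primary_eq_bot_of_isTotallyComplex (hPT : poitouTate_sha_tateDual K)
    [Finite (W.selmerGroupPInfty p)] (hK : ∀ P : W.toAffine.Point, p • P = 0 → P = 0) :
    shaTwo (LocBridge.primaryGaloisModule W p) = ⊥ := by
  rw [eq_bot_iff]
  intro c hc
  rw [AddSubgroup.mem_bot]
  exact forall_mem_shaTwo_primary_eq_zero_of_isTotallyComplex W p hPT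
    (fun Q hQ ↦ W.eq_zero_of_forall_smul_eq (p := p) hK fun σ ↦ hQ σ) c hc

variable (κ : ZpExtension K p) {γ : absoluteGaloisGroup K}

/-- **DIV over a totally complex number field, every prime, modulo Poitou–Tate (a) alone**: for every `ℤ_p`-extension `κ`
of `K`, topological generator `γ`, and elliptic `W/K` with `Sel_{p^∞}(E/K)` finite and `E(K)[p] = 0`, every class
`s ∈ H¹(Gal(K̄/K_∞), E[p^∞])` is `conj_γ t − t` (Greenberg's Prop. 4.12 input «(γ−1)H = H», no Greenberg-1999 / Kato input,
no archimedean row). [cite: GreenbergLNM1716, §4 Appendix Prop. 4.10, Prop. 4.12 (pp. 116–119)] [cite: MilneADT2006, Ch. I, Thm. 4.10 (a)] -/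
theorem forall_exists_conjH1_sub_eq_of_isTotallyComplex (hγ : κ.IsTopGenerator γ)
    (hPT : poitouTate_sha_tateDual K) [Finite (W.selmerGroupPInfty p)]
    (hK : ∀ P : W.toAffine.Point, p • P = 0 → P = 0) (s : W.subgroupH1 p κ.kerSubgroup) :
    ∃ t : W.subgroupH1 p κ.kerSubgroup, W.conjH1 p κ.kerSubgroup γ t - t = s :=
  forall_exists_conjH1_sub_eq_of_shaTwo_eq_bot W p κ hγ (shaTwo_primary_eq_bot_of_isTotallyComplex W p hPT hK) s

/-- **No nonzero finite `Λ`-submodule in the Pontryagin dual of `H¹(K_∞, E[p^∞])`, `K` totally complex, every prime,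
modulo Poitou–Tate (a) alone** (Greenberg's Prop. 4.9 / 4.12 conclusion for the full group `H¹(Gal(K̄/K_∞), E[p^∞])`).
[cite: GreenbergLNM1716, §4 Appendix Prop. 4.9 (p. 113), Prop. 4.12 (p. 119)] [cite: Washington1997, §13.2] -/
theorem dual_forall_finite_eq_bot_of_isTotallyComplex (hγ : κ.IsTopGenerator γ)
    (hPT : poitouTate_sha_tateDual K) [Finite (W.selmerGroupPInfty p)]
    (hK : ∀ P : W.toAffine.Point, p • P = 0 → P = 0)
    {Y : Type*} [AddCommGroup Y] [Module (IwasawaAlgebra p) Y]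
    (dY : Y →+ (W.subgroupH1 p κ.kerSubgroup →+ AddCircle (1 : ℚ))) (hinj : Function.Injective dY)
    (hT : ∀ (y : Y) (x : W.subgroupH1 p κ.kerSubgroup),
      dY ((PowerSeries.X : IwasawaAlgebra p) • y) x = dY y (W.conjH1 p κ.kerSubgroup γ x) - dY y x) :
    ∀ N : Submodule (IwasawaAlgebra p) Y, Finite N → N = ⊥ :=
  dual_forall_finite_eq_bot_of_shaTwo_eq_bot W p κ hγ (shaTwo_primary_eq_bot_of_isTotallyComplex W p hPT hK)
    dY hinj hT

end Summit.BirchSwinnertonDyer.BirchSwinnertonDyer.Theorems.SignedEC.PrimaryTorsionH2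

end
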